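import Summits.BirchSwinnertonDyer.BirchSwinnertonDyer.Theorems.ByReductionTypeAtTwoSupersingularFlatLocalDualityMapLambda
import Summits.BirchSwinnertonDyer.BirchSwinnertonDyer.Theorems.ByReductionTypeAtTwoSupersingularFlatKernelBidual
import Summits.BirchSwinnertonDyer.BirchSwinnertonDyer.Theorems.ByReductionTypeAtTwoSupersingularFlatPairFun
import Summits.BirchSwinnertonDyer.BirchSwinnertonDyer.Theorems.ThetaPartnerAtTwoSignedKatoUpToAtTwoLayerPairingCompat
import Literature.NumberTheory.EllipticCurves.Kato2004.IwasawaH1TowerLimitProofs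
import Literature.NumberTheory.EllipticCurves.Kato2004.IntegralH1CorestrictionMackey
import HarnessLib

/-!
# Route `ByReductionTypeAtTwo` (rung K4), crux `SupersingularRankZeroAtTwo` (item stmt-BirchSwinnertonDyer-19097), line
# `odd_blind_package` v2.17, stub `stub_flatPackage`, conjunct (8), clause F1♭ `Exact loc toX` — **THE Λ-ADIC PASSAGE OF THE
# ONE-PLACE POITOU–TATE CONVERSE («ker toX ⊆ range loc») FROM ITS FINITE LEVELS, KEY-AGNOSTIC**: `L(𝐇¹_Γ) + Ker Col♭` is CLOSED
# in the points model of `H¹_Iw(ℚ_v, T_pW)`, and the ♭-kernel closing step (cell `bsd-2adic`, seat `bsd-2adic-t42` GEN 49, hand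
# hF1♭-LIM; `--supports 19097`, helper)

HONEST FRAMING (D-0054): THEOREMS ONLY — no definition, no named fact, no instance, no notation, no `sorry`.  Helper toward
conjunct (8); closes NO stub; 19097 stays OPEN on its 5 registered stubs (v2.17); nothing is booked; BSD₂ is proved for no
supersingular curve and BSD for no curve by any of this; typed ≠ proved.  Generic prime `p` (no `p ≠ 2`, no «upto ×2»).

## What and why

Conjunct (8) displays `Exact loc toX` for `loc := Col♭ ∘ₗ L : I.H →ₗ[Λ] Λ` (`L` = the `Λ`-linear localisation of
`SSFlatPackage.exists_linearMap_pairFun_tatePairing`, p830262) and `toX := ν̄` (`SSFlatPackage.exists_flatLocalDualityHom_lambda`,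
file 5 of tower-1 GEN 67).  Its half «`ker toX ⊆ range loc`» is, after (V̄) and the injectivity of `D.toDual`, the KEY-AGNOSTIC
statement T-LIM: every functional `w : E(ℚ_∞·ℚ_v) →+ ℤ_p` whose Kummer values on ♭-Selmer data vanish (ORTH) satisfies
`(J (L x)).2 = (J w).2` for some `x ∈ I.H` — «`w ≡ loc x (mod Ker Col♭)`».  The carrier census of this hand (STATUS
2026-08-31, PLAN/(D1)) found the LIMIT machinery entirely in the tree and the FINITE-LEVEL instance of the one-place converse
(`SSFlatPT.pairing_localization_eq_zero_iff_canonical`, p830701, over the layer `ℚ_n` with coefficients `W[p^k]`) NOT yet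
expressible by name in the layer currency (joint J1: the Shapiro / layer-number-field dictionary; joint J3: finiteness and the
passage of layer Selmer classes to `Sel♭(ℚ_∞)`).  This file therefore proves the Λ-ADIC PASSAGE ONCE, with the two finite-level
inputs DISPLAYED as hypotheses in the tree's layer currency:

* (LEV) — the levelwise converse for `w`: for every `n, k` some INTEGRAL class `a ∈ H¹(ℚ_n, W[p^k])`
  (`Kato2004.integralH1`: unramified away from `p` at class level) has layer Tate pairing
  `⟨a, Q⟩_{n,p^k} = w(Q) mod p^k` (`CyclotomicLayer.layerPairingMod` for THE Weil pairings `CyclotomicLayer.weilTowerPk`, the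
  torsion-level currency of `CyclotomicLayer.tatePairingPk`) with every ♭-TEST POINT `Q ∈ E(ℚ_{n,v})` of level `k`
  (`p^k ∣ z'(Q)` for all `z' ∈ Ker Col♭` — Sprung's `E♭`, Def. 7.9).  NOT YET SUPPLIED BY THE TREE: it is p830701 at `(ℚ_n, p^k)`
  read through J1/J3 (hand hF1♭-LEV); for ORTH `w` it is what the finite-level Poitou–Tate converse gives.
* (FIN) — for every `n, k` the integral classes of `H¹(ℚ_n, W[p^k])` form a finite set (Hermite–Minkowski at `ℚ_n`;
  in the tree only for `Γ_ℚ` itself, `finite_h1Unramified_holds`, and `Kato2004.module_finite_integralH1_layerZero`) — NOT YET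
  SUPPLIED for `n ≥ 1` (typing ask FIN-LAYER).

Every other input is a habitat binder of p830262 / file 5 (`hκ`, `hv`, `hg`, `hap`, the Honda levels `hc` and trace relations
`hTr` of H2-F1F3's family, `J` with `hJ`, `I`, `L` with its displayed residue clause) — NO `D`, `Y`, `ν`, `γ⁻¹`: key-agnostic.

## What is proved
* §1 glue on the double tower `(H¹(ℚ_n, W[p^k]))_{n,k}`: `reduceTorsionH1_mem_integralH1` (`p_*` preserves integrality),
  `cohomologyMap_torsionPow_eq_reduceTorsionH1` (`p_*` = change of coefficients along `LayerPairing.torsionPow`),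
  ★ `layerPairingMod_reduceTorsionH1` — LEVEL COMPATIBILITY of the layer Tate pairings on TORSION classes
  (`⟨a, Q⟩_{n,p^{k+1}} mod p^k = ⟨p_* a, Q⟩_{n,p^k}`; the torsion twin of `LayerPairing.layerPairingPk_succ_compat`), and two
  `ℤ/p^k` trivialities.
* §2 ★ `snd_coleman_eq_of_forall_annihilator_dvd` — THE ♭-KERNEL CLOSING STEP: if `p^k ∣ z(y) − w(y)` for every ♭-annihilator
  datum `(y, k)` then `(J z).2 = (J w).2` (`(Ker Col♭)^⊥⊥ = Ker Col♭`, `SSFlatEC.mem_colemanKer_flat_of_forall_annihilator_dvd`, and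
  `Ker Col♭ = ker (snd ∘ J)`, `OddBlindNF.mem_colemanKer_flat_iff_snd_eq_zero`).
* §3 ★★ `exists_snd_coleman_apply_eq_of_levelwise` — T-LIM FROM (LEV) ∧ (FIN): Kőnig for the double tower
  (`Kato2004.exists_compatible_of_finite_nonempty`) on the finite non-empty sets of integral classes with the displayed agreement,
  stable under `p_*` (§1) and the trace maps (`Kato2004.layerCores_mem_integralH1`, `LayerPairing.layerPairingMod_layerCores`);
  the doubly compatible family IS `(red_{p^k} proj_n x)` for a unique `x ∈ 𝐇¹_Γ` (`Kato2004.IwasawaH1Data.existsUnique_of_compatible`);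
  the residue clause of `L` and §2 conclude.

References: [Kato2004Asterisque] §8.2 (p. 181), §12.2 (p. 220), §13.8 (pp. 228–229), §17.13 (p. 279); [Rubin2000] App. B
Prop. B.2.3, §B.3; [GreenbergLNM1716] §4 pp. 121–122 («`G` and `G*` are also orthogonal complements»); [Kobayashi2003] (7.17)–(7.21)
(p. 12), (8.23) (p. 18); [Sprung2012] Def. 7.9, Lemma 7.10, Def. 7.11 (p. 1503), Prop. 5.7 (p. 1495); [PerrinRiou1994Invent]
§3.6.1; [SilvermanAEC2009] Prop. III.8.1(e); [MilneADT2006] Ch. I Thm. 4.10(b).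
-/

set_option autoImplicit false
-- the Theorems namespace of this sub repeats the summit name by design (D-0017 nested layout)
set_option linter.dupNamespace false

noncomputable section

open scoped Classical NumberField

namespace Summit.BirchSwinnertonDyer.BirchSwinnertonDyer.Theorems

namespace SSFlatPT

open CategoryTheory NumberField IsDedekindDomain Field WeierstrassCurve ContinuousCohomology
  Literature.NumberTheory.EllipticCurves Literature.NumberTheory.GaloisRepresentations
  Literature.NumberTheory.EllipticCurves.Sprung2012 Literature.NumberTheory.EllipticCurves.Sprung2017
  Literature.NumberTheory.EllipticCurves.Kobayashi2003 Literature.NumberTheory.EllipticCurves.Kato2004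
  Literature.NumberTheory.EllipticCurves.Kato2004.EulerSystemValues ZpExtension

variable (W : WeierstrassCurve ℚ) [W.IsElliptic] {p : ℕ} [Fact p.Prime]

/-! ## §1 Glue on the double tower `(H¹(ℚ_n, W[p^k]))_{n,k}`: `p_*` preserves integrality, `p_*` as a change of
coefficients along `SignedKatoOffTwo.LayerPairing.torsionPow`, and the LEVEL COMPATIBILITY of the layer Tate pairings on
TORSION classes -/

/-- In `ℤ/p^{k+1}`: an element killed by `p` dies in `ℤ/p^k` (it is a multiple of `p^k`). [folklore] -/
theorem zmodCastHom_eq_zero_of_prime_mul_eq_zero (k : ℕ) (a : ZMod (p ^ (k + 1)))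
    (h : (p : ZMod (p ^ (k + 1))) * a = 0) :
    ZMod.castHom (Dvd.intro p (pow_succ p k).symm) (ZMod (p ^ k)) a = 0 := by
  obtain ⟨n, rfl⟩ := ZMod.intCast_surjective a
  rw [map_intCast, ZMod.intCast_zmod_eq_zero_iff_dvd]
  have hdvd : ((p ^ (k + 1) : ℕ) : ℤ) ∣ (p : ℤ) * n := by
    rw [← ZMod.intCast_zmod_eq_zero_iff_dvd]; push_cast; exact h
  rw [Nat.cast_pow, pow_succ'] at hdvd
  exact (mul_dvd_mul_iff_left (by exact_mod_cast (Fact.out : p.Prime).ne_zero)).mp hdvd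

/-- `(x mod p^{k+1}) mod p^k = x mod p^k` on `ℤ_p` (`PadicInt.zmod_cast_comp_toZModPow`). [folklore] -/
theorem zmodCastHom_toZModPow_succ (k : ℕ) (x : ℤ_[p]) :
    ZMod.castHom (Dvd.intro p (pow_succ p k).symm) (ZMod (p ^ k)) (PadicInt.toZModPow (k + 1) x) =
      PadicInt.toZModPow k x := by
  rw [← PadicInt.zmod_cast_comp_toZModPow (p := p) k (k + 1) (Nat.le_succ k)]
  rfl

omit [W.IsElliptic] [Fact p.Prime] in
/-- `p_* : H¹(U, W[p^{k+1}]) → H¹(U, W[p^k])` preserves the integral classes (unramified away from `p` at class level):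
`p_*` commutes with restriction to `U ⊓ I_𝔓` (`Kato2004.reduceTorsionH1_resLe`). [cite: Kato2004Asterisque, §8.2 (pp. 180–181)]
[cite: PerrinRiou1987BSMF, §0 (p. 401)] -/
theorem reduceTorsionH1_mem_integralH1 (k : ℕ) (U : Subgroup (absoluteGaloisGroup ℚ))
    {c : W.torsionH1Over ((p : ℤ) ^ (k + 1)) U}
    (hc : c ∈ integralH1 (W.torsionGaloisModule ((p : ℤ) ^ (k + 1))) p U) :
    W.reduceTorsionH1 p k U c ∈ integralH1 (W.torsionGaloisModule ((p : ℤ) ^ k)) p U := by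
  refine (mem_integralH1_iff _ _ _ _).mpr fun v hv 𝔓 h𝔓 ↦ ?_
  have h := Kato2004.reduceTorsionH1_resLe W p k (inf_le_left : U ⊓ 𝔓.inertia (absoluteGaloisGroup ℚ) ≤ U) c
  rw [(mem_integralH1_iff _ _ _ _).mp hc v hv 𝔓 h𝔓] at h
  refine h.symm.trans ?_
  exact map_zero _

omit [W.IsElliptic] [Fact p.Prime] in
/-- `p_*` (`WeierstrassCurve.reduceTorsionH1`) IS the change of coefficients along `[p] : W[p^{k+1}] ⟶ W[p^k]` read with the
`ℕ`-cast indices (`SignedKatoOffTwo.LayerPairing.torsionPow`) — the same map on cocycles. [cite: SerreGaloisCohomology1997, I §2.2]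
[cite: PerrinRiou1987BSMF, §0 (p. 401)] -/
theorem cohomologyMap_torsionPow_eq_reduceTorsionH1 (k : ℕ) (U : Subgroup (absoluteGaloisGroup ℚ))
    (c : W.torsionH1Over ((p : ℤ) ^ (k + 1)) U) :
    cohomologyMap (subgroupRepMap (SignedKatoOffTwo.LayerPairing.torsionPow W k) U) 1 c = W.reduceTorsionH1 p k U c := by
  obtain ⟨φ, rfl⟩ := oneCocycleClass_surjective (subgroupRep (W.torsionGaloisModule ((p : ℤ) ^ (k + 1))).toTopRep U) c
  rw [Kato2004.reduceTorsionH1_oneCocycleClass]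
  erw [cohomologyMap_oneCocycleClass]
  congr 1

variable {W} in
/-- **LEVEL COMPATIBILITY of the layer Tate pairings on TORSION classes**: for `c ∈ H¹(Γ_n, W[p^{k+1}])` and `Q ∈ E(ℚ_{n,v})`,
`⟨c, Q⟩_{n,p^{k+1}} mod p^k = ⟨p_* c, Q⟩_{n,p^k}` for THE Weil pairings `weilTowerPk` — the torsion-class twin of
`SignedKatoOffTwo.LayerPairing.layerPairingPk_succ_compat` (same six compatibilities: localisation, Shapiro, Kummer, summed cup
products, invariant maps, and §1's `p_*`). [cite: SilvermanAEC2009, Prop. III.8.1(e)] [cite: Kobayashi2003, (8.23) (p. 18)]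
[cite: PerrinRiou1994Invent, §3.6.1] -/
theorem layerPairingMod_reduceTorsionH1 (κ : ZpExtension ℚ p) (v : HeightOneSpectrum (𝓞 ℚ)) (n k : ℕ)
    (c : W.torsionH1Over ((p : ℤ) ^ (k + 1)) (κ.layerSubgroup n))
    (Q : localLayerPointsOfEmb κ (closureEmb (K := ℚ) (v.adicCompletion ℚ)) W n) :
    (ZMod.castHom (Dvd.intro p (pow_succ p k).symm) (ZMod (p ^ k)))
        (CyclotomicLayer.layerPairingMod W (p ^ (k + 1)) (CyclotomicLayer.weilTowerPk W (k + 1))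
          (CyclotomicLayer.weilTowerPk_pow W (k + 1)) (CyclotomicLayer.weilTowerPk_add_left W (k + 1))
          (CyclotomicLayer.weilTowerPk_add_right W (k + 1)) (CyclotomicLayer.weilTowerPk_smul W (k + 1)) κ v n c Q) =
      CyclotomicLayer.layerPairingMod W (p ^ k) (CyclotomicLayer.weilTowerPk W k) (CyclotomicLayer.weilTowerPk_pow W k)
        (CyclotomicLayer.weilTowerPk_add_left W k) (CyclotomicLayer.weilTowerPk_add_right W k)
        (CyclotomicLayer.weilTowerPk_smul W k) κ v n (W.reduceTorsionH1 p k (κ.layerSubgroup n) c) Q := by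
  -- cup products need `LocallyCompactSpace Γ_v`: the compactness of the absolute Galois group, locally (Prop-valued, no data)
  haveI : CompactSpace (absoluteGaloisGroup (v.adicCompletion ℚ)) := absoluteGaloisGroup_compactSpace _
  rw [← SignedKatoOffTwo.LayerPairing.layerPairingMod_eq_cyclotomicLayer,
    ← SignedKatoOffTwo.LayerPairing.layerPairingMod_eq_cyclotomicLayer,
    SignedKatoOffTwo.LayerPairing.layerPairingMod_apply, SignedKatoOffTwo.LayerPairing.layerPairingMod_apply,
    ← cohomologyMap_torsionPow_eq_reduceTorsionH1]
  have h := SignedKatoOffTwo.LayerPairing.invAt_cohomologyMap_muLocalPow v k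
    ((SignedKatoOffTwo.LayerPairing.layerSumPairing W (p ^ (k + 1)) (SignedKatoOffTwo.LayerPairing.weilTowerPk W (k + 1))
      (SignedKatoOffTwo.LayerPairing.weilTowerPk_pow W (k + 1)) (SignedKatoOffTwo.LayerPairing.weilTowerPk_add_left W (k + 1))
      (SignedKatoOffTwo.LayerPairing.weilTowerPk_add_right W (k + 1))
      (SignedKatoOffTwo.LayerPairing.weilTowerPk_smul W (k + 1)) κ v n).cupProduct
      (SignedKatoOffTwo.LayerPairing.layerShapiro W (p ^ (k + 1)) κ v n (SignedKatoOffTwo.LayerPairing.layerLoc W (p ^ (k + 1)) κ v n c))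
      (SignedKatoOffTwo.LayerPairing.layerShapiro W (p ^ (k + 1)) κ v n
        (SignedKatoOffTwo.LayerPairing.layerKummer W (p ^ (k + 1)) κ v n Q)))
  rw [SignedKatoOffTwo.LayerPairing.cupProduct_layerSumPairing_succ W κ v k (SignedKatoOffTwo.LayerPairing.weilTowerPk W) _ _ _ _
    (SignedKatoOffTwo.LayerPairing.weilTowerPk_torsionPow W) n] at h
  unfold SignedKatoOffTwo.LayerPairing.layerShapiro at h ⊢
  rw [← shapiroLift_cohomologyMap, ← shapiroLift_cohomologyMap,
    ← SignedKatoOffTwo.LayerPairing.layerLoc_cohomologyMap_torsionPow,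
    SignedKatoOffTwo.LayerPairing.cohomologyMap_torsionLocalPow_layerKummer] at h
  exact h.symm

/-! ## §2 The ♭-KERNEL CLOSING STEP: a functional that agrees with `w` on the ♭-annihilator data has the same `Col♭` -/

variable (κ : ZpExtension ℚ p) (v : HeightOneSpectrum (𝓞 ℚ)) {ap : ℤ} {g : absoluteGaloisGroup (v.adicCompletion ℚ)}
  {c : ℕ → localPoints W (v.adicCompletion ℚ)}

omit [W.IsElliptic] in
/-- ★ **The ♭-kernel closing step** (key-agnostic).  Let `J` be a `Λ`-linear ♭ Coleman family (`Col(z) = J z`) for a local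
`g` restricting to a topological generator, `p ∣ a_p`, levels `c_n ∈ E(ℚ_{n,v})` with the `n ≥ 1` trace relations.  If two
functionals `z, w` on `E(ℚ_∞·ℚ_v)` satisfy `p^k ∣ z(y) − w(y)` for every ♭-ANNIHILATOR datum `(y, k)` — every `y` and `k` with
`p^k ∣ z'(y)` for all `z' ∈ Ker Col♭` (Sprung's `E♭_{∞,𝔭}` = exact annihilator of `Ker Col♭`, Def. 7.9) — then `Col♭(z) = Col♭(w)`:
`z − w ∈ (Ker Col♭)^⊥⊥ = Ker Col♭` (`SSFlatEC.mem_colemanKer_flat_of_forall_annihilator_dvd`, parts 16–17 of the ♭ port) and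
`Ker Col♭ = ker (snd ∘ J)` (`OddBlindNF.mem_colemanKer_flat_iff_snd_eq_zero`).  This is the form in which the Λ-adic passage
below (and the consumer of conjunct (8)) concludes «`loc x ≡ w (mod Ker Col♭)`».
[cite: Sprung2012, Def. 7.9 and Lemma 7.10 (p. 1503), Prop. 5.7 (p. 1495)] [cite: Kobayashi2003, (8.23) (p. 18)] -/
theorem snd_coleman_eq_of_forall_annihilator_dvd
    (hg : κ.IsTopGenerator (resGalOfEmb (closureEmb (K := ℚ) (v.adicCompletion ℚ)) g)) (hap : (p : ℤ) ∣ ap)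
    (hc : ∀ n, c n ∈ localLayerPointsOfEmb κ (closureEmb (K := ℚ) (v.adicCompletion ℚ)) W n)
    (hTr : ∀ n, 1 ≤ n → localTraceOfEmb κ (closureEmb (K := ℚ) (v.adicCompletion ℚ)) W n (n + 1) (c (n + 1)) =
      ap • c n - c (n - 1))
    (J : letI := moduleOfGenerator κ (closureEmb (K := ℚ) (v.adicCompletion ℚ)) W hg
      (localTowerPointsOfEmb κ (closureEmb (K := ℚ) (v.adicCompletion ℚ)) W →+ ℤ_[p]) →ₗ[IwasawaAlgebra p]
        IwasawaAlgebra p × IwasawaAlgebra p)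
    (hJ : ∀ z, IsColemanPair κ (closureEmb (K := ℚ) (v.adicCompletion ℚ)) W ap g c z (J z).1 (J z).2)
    (z w : localTowerPointsOfEmb κ (closureEmb (K := ℚ) (v.adicCompletion ℚ)) W →+ ℤ_[p])
    (h : ∀ (y : localTowerPointsOfEmb κ (closureEmb (K := ℚ) (v.adicCompletion ℚ)) W) (k : ℕ),
      (∀ z' ∈ colemanKer κ (closureEmb (K := ℚ) (v.adicCompletion ℚ)) W ap g c .flat, (p : ℤ_[p]) ^ k ∣ z' y) →
        (p : ℤ_[p]) ^ k ∣ z y - w y) :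
    (J z).2 = (J w).2 := by
  letI := moduleOfGenerator κ (closureEmb (K := ℚ) (v.adicCompletion ℚ)) W hg
  have hmem : z - w ∈ colemanKer κ (closureEmb (K := ℚ) (v.adicCompletion ℚ)) W ap g c .flat :=
    SSFlatEC.mem_colemanKer_flat_of_forall_annihilator_dvd κ (closureEmb (K := ℚ) (v.adicCompletion ℚ)) W hap hg hc
      hTr (z - w) fun y k hy ↦ by rw [AddMonoidHom.sub_apply]; exact h y k hy
  have h0 : (J (z - w)).2 = 0 :=
    (OddBlindNF.mem_colemanKer_flat_iff_snd_eq_zero hap (fun z ↦ J z) (Js := fun z ↦ (J z).1) hJ (z - w)).mp hmem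
  rwa [map_sub, Prod.snd_sub, sub_eq_zero] at h0

/-! ## §3 T-LIM FROM THE LEVELWISE CONVERSE: `L(𝐇¹_Γ) + Ker Col♭` is CLOSED in `H¹_Iw(ℚ_v, T_pW)` (points model) -/

variable [ContinuousSMul ℤ_[p] (W.tateModule p)]

/-- ★★ **The Λ-adic passage («ker toX ⊆ range loc» from its finite levels), key-agnostic.**  Data: the cyclotomic `κ`,
`v ∣ p`, a local `g` restricting to a topological generator, `p ∣ a_p`, levels `c_n ∈ E(ℚ_{n,v})` with the trace relations, a
`Λ`-linear ♭ Coleman family `J`, a pin `I : 𝐇¹_Γ(T_pW)` and ANY `L : I.H → Hom(E(ℚ_∞·ℚ_v), ℤ_p)` with the residue clause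
`L x Q mod p^k = ⟨proj_n x, Q⟩_{n,p^k}` (`CyclotomicLayer.tatePairingPk`; the displayed clause of
`SSFlatPackage.exists_linearMap_pairFun_tatePairing`), and a functional `w`.  HYPOTHESES: (FIN) for every `n, k` the INTEGRAL
classes of `H¹(ℚ_n, W[p^k])` (unramified away from `p` at class level, `Kato2004.integralH1`) form a finite set
(Hermite–Minkowski at the layer `ℚ_n`); (LEV) for every `n, k` some integral `a ∈ H¹(ℚ_n, W[p^k])` has layer Tate pairing
`⟨a, Q⟩_{n,p^k} = w(Q) mod p^k` with every ♭-TEST POINT `Q ∈ E(ℚ_{n,v})` of level `k` (`p^k ∣ z'(Q)` for all `z' ∈ Ker Col♭`) — the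
levelwise one-place Poitou–Tate converse for `w`.  CONCLUSION: `∃ x ∈ 𝐇¹_Γ(T_pW)` with `Col♭(L x) = Col♭(w)`.
PROOF: the sets `S n k` of integral classes with that agreement are finite (FIN), non-empty (LEV), and stable under
`p_* : H¹(ℚ_n, W[p^{k+1}]) → H¹(ℚ_n, W[p^k])` (§1 `layerPairingMod_reduceTorsionH1`, `reduceTorsionH1_mem_integralH1`; a level-`k`
test point `Q` gives the level-`(k+1)` test point `pQ`) and under the trace maps (`Kato2004.layerCores_mem_integralH1`,
`SignedKatoOffTwo.LayerPairing.layerPairingMod_layerCores` = (P1) mod `p^k`); Kőnig for the double tower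
(`Kato2004.exists_compatible_of_finite_nonempty`) gives a doubly compatible family, which IS `(red_{p^k} proj_n x)_{n,k}` for a unique
`x ∈ 𝐇¹_Γ` (`Kato2004.IwasawaH1Data.existsUnique_of_compatible`); by the residue clause `L x` agrees with `w` modulo `p^k` on every
♭-test point, i.e. on every ♭-annihilator datum, so §2 applies. [cite: Kato2004Asterisque, §8.2 (p. 181), §12.2 (p. 220), §17.13 (p. 279)]
[cite: Rubin2000, App. B Prop. B.2.3 and §B.3] [cite: GreenbergLNM1716, §4 p. 122] [cite: Kobayashi2003, (8.23) (p. 18)]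
[cite: Sprung2012, Def. 7.9 (p. 1503)] -/
theorem exists_snd_coleman_apply_eq_of_levelwise (hκ : κ.IsCyclotomic) (hv : (p : 𝓞 ℚ) ∈ v.asIdeal)
    (hg : κ.IsTopGenerator (resGalOfEmb (closureEmb (K := ℚ) (v.adicCompletion ℚ)) g)) (hap : (p : ℤ) ∣ ap)
    (hc : ∀ n, c n ∈ localLayerPointsOfEmb κ (closureEmb (K := ℚ) (v.adicCompletion ℚ)) W n)
    (hTr : ∀ n, 1 ≤ n → localTraceOfEmb κ (closureEmb (K := ℚ) (v.adicCompletion ℚ)) W n (n + 1) (c (n + 1)) =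
      ap • c n - c (n - 1))
    (J : letI := moduleOfGenerator κ (closureEmb (K := ℚ) (v.adicCompletion ℚ)) W hg
      (localTowerPointsOfEmb κ (closureEmb (K := ℚ) (v.adicCompletion ℚ)) W →+ ℤ_[p]) →ₗ[IwasawaAlgebra p]
        IwasawaAlgebra p × IwasawaAlgebra p)
    (hJ : ∀ z, IsColemanPair κ (closureEmb (K := ℚ) (v.adicCompletion ℚ)) W ap g c z (J z).1 (J z).2)
    {γ : absoluteGaloisGroup ℚ} (I : IwasawaH1Data W p κ γ)
    (L : I.H → (localTowerPointsOfEmb κ (closureEmb (K := ℚ) (v.adicCompletion ℚ)) W →+ ℤ_[p]))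
    (hL : ∀ (x : I.H) (n k : ℕ) (Q : localPoints W (v.adicCompletion ℚ))
        (hQ : Q ∈ localLayerPointsOfEmb κ (closureEmb (K := ℚ) (v.adicCompletion ℚ)) W n),
        PadicInt.toZModPow k (L x ⟨Q, localLayerPointsOfEmb_le_localTowerPointsOfEmb κ _ W n hQ⟩) =
          CyclotomicLayer.tatePairingPk W κ v n k (I.proj n x) ⟨Q, hQ⟩)
    (w : localTowerPointsOfEmb κ (closureEmb (K := ℚ) (v.adicCompletion ℚ)) W →+ ℤ_[p])
    (hfin : ∀ n k : ℕ, Set.Finite {a : W.torsionH1Over ((p : ℤ) ^ k) (κ.layerSubgroup n) |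
      a ∈ integralH1 (W.torsionGaloisModule ((p : ℤ) ^ k)) p (κ.layerSubgroup n)})
    (hlev : ∀ n k : ℕ, ∃ a : W.torsionH1Over ((p : ℤ) ^ k) (κ.layerSubgroup n),
      a ∈ integralH1 (W.torsionGaloisModule ((p : ℤ) ^ k)) p (κ.layerSubgroup n) ∧
      ∀ (Q : localPoints W (v.adicCompletion ℚ))
        (hQ : Q ∈ localLayerPointsOfEmb κ (closureEmb (K := ℚ) (v.adicCompletion ℚ)) W n),
        (∀ z' ∈ colemanKer κ (closureEmb (K := ℚ) (v.adicCompletion ℚ)) W ap g c .flat,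
          (p : ℤ_[p]) ^ k ∣ z' ⟨Q, localLayerPointsOfEmb_le_localTowerPointsOfEmb κ _ W n hQ⟩) →
        CyclotomicLayer.layerPairingMod W (p ^ k) (CyclotomicLayer.weilTowerPk W k) (CyclotomicLayer.weilTowerPk_pow W k)
            (CyclotomicLayer.weilTowerPk_add_left W k) (CyclotomicLayer.weilTowerPk_add_right W k)
            (CyclotomicLayer.weilTowerPk_smul W k) κ v n a ⟨Q, hQ⟩ =
          PadicInt.toZModPow k (w ⟨Q, localLayerPointsOfEmb_le_localTowerPointsOfEmb κ _ W n hQ⟩)) :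
    ∃ x : I.H, (J (L x)).2 = (J w).2 := by
  classical
  -- the candidate sets of the double tower
  set S : ∀ n k : ℕ, Set (W.torsionH1Over ((p : ℤ) ^ k) (κ.layerSubgroup n)) := fun n k ↦
    {a | a ∈ integralH1 (W.torsionGaloisModule ((p : ℤ) ^ k)) p (κ.layerSubgroup n) ∧
      ∀ (Q : localPoints W (v.adicCompletion ℚ))
        (hQ : Q ∈ localLayerPointsOfEmb κ (closureEmb (K := ℚ) (v.adicCompletion ℚ)) W n),
        (∀ z' ∈ colemanKer κ (closureEmb (K := ℚ) (v.adicCompletion ℚ)) W ap g c .flat,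
          (p : ℤ_[p]) ^ k ∣ z' ⟨Q, localLayerPointsOfEmb_le_localTowerPointsOfEmb κ _ W n hQ⟩) →
        CyclotomicLayer.layerPairingMod W (p ^ k) (CyclotomicLayer.weilTowerPk W k) (CyclotomicLayer.weilTowerPk_pow W k)
            (CyclotomicLayer.weilTowerPk_add_left W k) (CyclotomicLayer.weilTowerPk_add_right W k)
            (CyclotomicLayer.weilTowerPk_smul W k) κ v n a ⟨Q, hQ⟩ =
          PadicInt.toZModPow k (w ⟨Q, localLayerPointsOfEmb_le_localTowerPointsOfEmb κ _ W n hQ⟩)} with hS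
  have hSfin : ∀ n k, (S n k).Finite := fun n k ↦ (hfin n k).subset fun a ha ↦ ha.1
  have hSne : ∀ j, (S j j).Nonempty := fun j ↦ by
    obtain ⟨a, ha, ha'⟩ := hlev j j
    exact ⟨a, ha, ha'⟩
  -- stability under `p_*`: a level-`k` test point `Q` gives the level-`(k+1)` test point `p • Q`
  have hSk : ∀ n k, ∀ a ∈ S n (k + 1), W.reduceTorsionH1 p k (κ.layerSubgroup n) a ∈ S n k := by
    intro n k a ha
    obtain ⟨hint, hagree⟩ := ha
    refine ⟨reduceTorsionH1_mem_integralH1 W k _ hint, fun Q hQ htest ↦ ?_⟩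
    have hpQ : p • Q ∈ localLayerPointsOfEmb κ (closureEmb (K := ℚ) (v.adicCompletion ℚ)) W n :=
      AddSubgroup.nsmul_mem _ hQ p
    have hyy : (⟨p • Q, localLayerPointsOfEmb_le_localTowerPointsOfEmb κ _ W n hpQ⟩ :
          localTowerPointsOfEmb κ (closureEmb (K := ℚ) (v.adicCompletion ℚ)) W) =
        p • ⟨Q, localLayerPointsOfEmb_le_localTowerPointsOfEmb κ _ W n hQ⟩ := rfl
    have hQQ : (⟨p • Q, hpQ⟩ : localLayerPointsOfEmb κ (closureEmb (K := ℚ) (v.adicCompletion ℚ)) W n) = p • ⟨Q, hQ⟩ :=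
      rfl
    have htest' : ∀ z' ∈ colemanKer κ (closureEmb (K := ℚ) (v.adicCompletion ℚ)) W ap g c .flat,
        (p : ℤ_[p]) ^ (k + 1) ∣ z' ⟨p • Q, localLayerPointsOfEmb_le_localTowerPointsOfEmb κ _ W n hpQ⟩ := by
      intro z' hz'
      rw [hyy, map_nsmul, nsmul_eq_mul, pow_succ']
      exact mul_dvd_mul_left (p : ℤ_[p]) (htest z' hz')
    have h1 := hagree (p • Q) hpQ htest'
    rw [hQQ, hyy, map_nsmul, map_nsmul, map_nsmul, nsmul_eq_mul, nsmul_eq_mul] at h1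
    have h2 : (p : ZMod (p ^ (k + 1))) *
        (CyclotomicLayer.layerPairingMod W (p ^ (k + 1)) (CyclotomicLayer.weilTowerPk W (k + 1))
            (CyclotomicLayer.weilTowerPk_pow W (k + 1)) (CyclotomicLayer.weilTowerPk_add_left W (k + 1))
            (CyclotomicLayer.weilTowerPk_add_right W (k + 1)) (CyclotomicLayer.weilTowerPk_smul W (k + 1)) κ v n a ⟨Q, hQ⟩ -
          PadicInt.toZModPow (k + 1) (w ⟨Q, localLayerPointsOfEmb_le_localTowerPointsOfEmb κ _ W n hQ⟩)) = 0 := by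
      rw [mul_sub, h1, sub_self]
    have h3 := zmodCastHom_eq_zero_of_prime_mul_eq_zero (p := p) k _ h2
    rwa [map_sub, sub_eq_zero, layerPairingMod_reduceTorsionH1, zmodCastHom_toZModPow_succ] at h3
  -- stability under the trace maps: (P1) modulo `p^k`
  have hSn : ∀ n k, ∀ a ∈ S (n + 1) k,
      layerCores (W.torsionGaloisModule ((p : ℤ) ^ k)) κ n a ∈ S n k := by
    intro n k a ha
    obtain ⟨hint, hagree⟩ := ha
    refine ⟨Kato2004.layerCores_mem_integralH1 _ κ n hint, fun Q hQ htest ↦ ?_⟩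
    have hQ' := localLayerPointsOfEmb_mono κ (closureEmb (K := ℚ) (v.adicCompletion ℚ)) W (Nat.le_succ n) hQ
    have hP1 := SignedKatoOffTwo.LayerPairing.layerPairingMod_layerCores W (p ^ k) (CyclotomicLayer.weilTowerPk W k)
      (CyclotomicLayer.weilTowerPk_pow W k) (CyclotomicLayer.weilTowerPk_add_left W k)
      (CyclotomicLayer.weilTowerPk_add_right W k) (CyclotomicLayer.weilTowerPk_smul W k) κ v hκ hv n a Q hQ
    exact hP1.trans (hagree Q hQ' htest)
  -- Kőnig for the double tower, and the Λ-adic class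
  obtain ⟨a, haS, hak, han⟩ := Kato2004.exists_compatible_of_finite_nonempty W p κ S hSfin hSne hSk hSn
  obtain ⟨x, hx, -⟩ :=
    Kato2004.IwasawaH1Data.existsUnique_of_compatible W p I a hak han fun n k ↦ (haS n k).1
  refine ⟨x, snd_coleman_eq_of_forall_annihilator_dvd W κ v hg hap hc hTr J hJ (L x) w fun y k hy ↦ ?_⟩
  -- `y` lies in some layer `n`; there `L x` and `w` agree modulo `p^k` on the ♭-test point `y`
  obtain ⟨n, hn⟩ := exists_mem_localLayerPointsOfEmb_of_mem_localTowerPointsOfEmb κ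
    (closureEmb (K := ℚ) (v.adicCompletion ℚ)) W y.2
  have e1 := hL x n k (y : localPoints W (v.adicCompletion ℚ)) hn
  have e2 := (haS n k).2 (y : localPoints W (v.adicCompletion ℚ)) hn hy
  have e3 : CyclotomicLayer.tatePairingPk W κ v n k (I.proj n x) ⟨(y : localPoints W (v.adicCompletion ℚ)), hn⟩ =
      CyclotomicLayer.layerPairingMod W (p ^ k) (CyclotomicLayer.weilTowerPk W k) (CyclotomicLayer.weilTowerPk_pow W k)
        (CyclotomicLayer.weilTowerPk_add_left W k) (CyclotomicLayer.weilTowerPk_add_right W k)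
        (CyclotomicLayer.weilTowerPk_smul W k) κ v n (a n k) ⟨(y : localPoints W (v.adicCompletion ℚ)), hn⟩ := by
    rw [← hx n k]
    rfl
  have key : PadicInt.toZModPow k (L x y - w y) = 0 := by
    rw [map_sub, sub_eq_zero]
    exact e1.trans (e3.trans e2)
  rw [← Ideal.mem_span_singleton, ← PadicInt.ker_toZModPow]
  exact key

end SSFlatPT

end Summit.BirchSwinnertonDyer.BirchSwinnertonDyer.Theorems

end
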